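import Summits.KontsevichZagierPeriods.KontsevichZagierPeriods.Theorems.RootDecompRationalCubeDichotomyRankDescentP14
import Literature.NumberTheory.Transcendental.BoxCoordinatePowerMap

/-! # `RootDecompRationalCubeDichotomyRankDescentP15` — part 1/9 of the mechanical ≤400-line split of `RankDescent_delta_v12_to_v14h_P15plus.lean` (sha256 311877f354eea7b0…)
Source: decomp-kz lens-2 g15 RankDescent_delta_v12_to_v14h_P15plus.lean @311877f3 (critic CLEARED g7-6 l.1400: 26322 ⟺ LetterDegenerateKernel, GenericKernel THEOREM); --supports stmt-KontsevichZagierPeriods-26322.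
Split by census-1 g10 `gen/splitlean.py`: scopes re-opened with their `open`/`variable`/`set_option` context; mathematics and declaration order unchanged. -/

/-!
# `RankDescent` §17–§18h — the DELTA `v12 → v14h` for crux 26322 `RationalCubePiKernelSingle`
(decomp-kz lens-2 g14 §17 + g15 §18, §18b, §18c, §18d, §18e, §18e-bis, §18f, §18g, §18h; route `RootDecompRationalCubeDichotomy`)

LANDING AID (one-writer rule: this seat proposes nothing). The tree is landing g13's `RankDescent_v12.lean`
(sha256 00885b8b…) as the mechanical ≤400-line chain `Theorems/RootDecompRationalCubeDichotomyRankDescentP01 … P14`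
(P01–P14 in the tree as of 2026-08-31T00:41:29Z). `RankDescent_v14h.lean` (HOME/decomp-kz-lens-2/g15/, sha256 in SHA256SUMS.txt)
differs from v12 ONLY by: one import (`BoxCoordinatePowerMap`), the title retag, a header-docblock addendum, and ONE pure
insertion of 2871 lines before the final `end <namespace>` (python-difflib opcodes v12→v14h:
`insert (6,5)→(6,6)`, `replace (8,9)→(9,10)`, `insert (222,221)→(223,285)`, `insert (3894,3893)→(3958,6828)`; nothing else touched). THIS FILE is exactly that insertion
(v14h l.3958–6828: `/-! ## §17 … -/`, `section Diophantine`, §17-bis `LSum`, `/-! ## §18 … -/`, `section LetterCriterion`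
with its sub-sections `TowerInstance`, `TwoPointInstance`, `SpecialResident`, `SubstitutionMove`, `LandenClass`,
`CanonicalSystem`) wrapped in the namespace with the one ambient `variable {M : ℕ}` of v12 (l.285) re-declared — i.e.
the text to split into `…RankDescentP15 … P2k` (`import …P14`) — ALL of P01–P14 are in the tree now, so this file
ELABORATES AS IS against the landed tree (farm `lean check`: rc 0, 0 err, 0 warn, 0 sorry, standard axioms — checks/delta_v14h_full_audit.json); its content is also kernel-checked as part of the monolith `RankDescent_v14h.lean` (rc 0, 0 err, 0 warn,
0 sorry, standard axioms; audit `rationalCubePiKernelSingle_of_special` proof.conditional BY NAME «proves …Theses.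
RootDecompRationalCubeDichotomy.RationalCubePiKernelSingle», `GenericKernel` proved-helper). At the cut only the namespace is open (no section), so the split is scope-clean; the landed chain made exactly two v12 helpers
`private` (`eval_eq_of_sub_mem`, `exists_pderiv_eq`) — private copies are supplied below, as in P02–P07.
-/

noncomputable section

open MeasureTheory Set MvPolynomial
open Literature.NumberTheory.Transcendental
open Literature.NumberTheory.Transcendental.KZ

namespace Summit.KontsevichZagierPeriods.RootDecompRationalCubeDichotomy.Rung26322.RankDescent

variable {M : ℕ}

/-! PRIVATE COPIES of the two v12 helpers that the landed P-chain PRIVATISED per part (`private theorem eval_eq_of_sub_mem`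
in P02–P05, `private theorem exists_pderiv_eq` in P04–P07 — verbatim from `…RankDescentP05.lean` l.14–41); every further split part
that uses them needs the same private copy (the P01–P14 landing recipe). Nothing else of v12 is invisible across the cut. -/

open MeasureTheory Set MvPolynomial in
open Literature.NumberTheory.Transcendental in
open Literature.NumberTheory.Transcendental.KZ in
/-- `∂_k`-antiderivatives exist in `ℚ[x]`. [folklore] -/
private theorem exists_pderiv_eq (k : Fin M) (P : MvPolynomial (Fin M) ℚ) :
    ∃ G : MvPolynomial (Fin M) ℚ, pderiv k G = P := by
  have hv : (Pi.single k (1:ℚ) : Fin M → ℚ) ≠ 0 := by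
    intro h
    have := congrFun h k
    simp at this
  obtain ⟨G, hG⟩ := exists_dirD_eq (Pi.single k (1:ℚ)) hv P
  refine ⟨G, ?_⟩
  have hs : (∑ j, (Pi.single k (1:ℚ) : Fin M → ℚ) j • (pderiv j G : MvPolynomial (Fin M) ℚ)) = pderiv k G := by
    rw [Finset.sum_eq_single k (fun j _ hj => by simp [hj])
      (fun h => (h (Finset.mem_univ k)).elim)]
    simp
  rw [dirD_apply, hs] at hG
  exact hG

open MeasureTheory Set MvPolynomial in
open Literature.NumberTheory.Transcendental in
open Literature.NumberTheory.Transcendental.KZ in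
/-- Soundness: congruent formal combinations have equal values. [cite: KontsevichZagier2001, §1.2] -/
private theorem eval_eq_of_sub_mem {x y : FormalRep} (h : x - y ∈ relations) : eval x = eval y := by
  have h' := relations_le_ker_eval_holds h
  rw [AddMonoidHom.mem_ker, map_sub] at h'
  exact sub_eq_zero.1 h'

/-! ## §17 (v13, g14) THE DIOPHANTINE DICHOTOMY on the Fermat–hyperbolic towers `Q = q₀ + x₀⋯x_{n-1}`

**Node (g14).** `26322 ⟸ (A) the EXACT side (§1–§16: value 0 is FREE, N = 0) ∧ (B) the LETTER-POOR
NON-EXACT side — every numerator over q₀ + x₀⋯x_{n-1}, every dimension n, DECIDED OUTRIGHT (N = 0)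
modulo ONE named Diophantine input ∧ (C) the letter-rich generic residual (Grothendieck-type).`
Side (B) is where the de Rham class of the integrand is NOT zero (`Λ(P) = diagAltm q₀ P ≠ 0` allowed) —
the first decision of that kind in this file; the special/generic cut of §17 is by the ARITHMETIC OF THE
LETTERS, not by exactness.

LETTERS. `L_j(q₀) := ∫_{[0,1]^j} dx/(q₀ + x₁⋯x_j)` (`letter`; `q₀ > 0 ∨ q₀ < −1` so that the denominator
is zero-free on the closed cube, `fhQ_ne_zero_of`). `L_1(q₀) = log((q₀+1)/q₀)` (`letter_one`, PROVED);
for `|q₀| > 1`, `L_j(q₀) = Σ_{k≥1} (−1)^{k−1} q₀^{−k} k^{−j} = −Li_j(−1/q₀)` for EVERY `j` (PROVED: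
`letter_hasSum` / `lettersArePolylogs` / `letter_eq_neg_polylog`, by dominated convergence of the geometric
expansion and `integral_cube_prod_pow : ∫_{[0,1]^j} (x₁⋯x_j)^k = (k+1)^{−j}`); hence
`lettersLinIndep_iff_polylog`: `LettersLinIndep q₀ n ⟺ 1, Li_1(−1/q₀), …, Li_n(−1/q₀)` are ℚ-linearly
independent (`polylogSeries j x = Σ_{m≥1} x^m/m^j`) — the hypothesis IS the literature's statement,
verbatim; `L_2(1) = π²/12`, `L_3(1) = (3/4)ζ(3)`.
THEOREM A (`fhV_inSpan`, PROVED): `∫_{[0,1]^n} P/(q₀ + ∏xᵢ) ∈ ℚ + ℚ·L_1 + … + ℚ·L_n` for every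
`P ∈ ℚ[x]`, and (`fhV_split`, `fhV_top`) the coefficient of the top letter `L_n` may be taken to be
§9's pure-diagonal functional `Λ(P)`: by `P ≡ Λ(P)·1 mod Ex0m` (§9) and the exact descent (§5), whose
face terms STAY IN THE TOWER (`fh_exact_rel` / `fhV_exact_descent`: faces `x_k = 1` have denominator
`q₀ + ∏_{i≠k} xᵢ`, faces `x_k = 0` the constant denominator `q₀`, `face_one_fn` / `face_zero_fn`).
THEOREM B (PROVED).  (i) `fermatHyperbolicResidual_of_topLetterNew`: if the top letter is NEW,
`L_{n+1}(q₀) ∉ ℚ + ℚ·L_1(q₀) + ⋯ + ℚ·L_n(q₀)` (`TopLetterNew q₀ n`), then §9's one-parameter residual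
`FermatHyperbolicResidual n q₀` HOLDS — vacuously: value `0` forces `Λ(P) = 0`
(`diagAltm_eq_zero_of_value_of_new`); conversely a value-`0` representation with `Λ ≠ 0` exhibits
`L_{n+1}` in the lower span (`topLetter_inSpan_of_witness`), so the residual is live EXACTLY where the
Diophantine statement fails.  (ii) `fh_decided`: if `1, L_1(q₀), …, L_n(q₀)` are ℚ-linearly independent
(`LettersLinIndep q₀ n` ⟺ every letter up to `n` is new) then EVERY `[ [0,1]^n, P/(q₀ + x₀⋯x_{n-1}) ]`
of value `0` is `≡ 0` — 26322 with `N = 0` in its own binders (`fermatHyperbolic_single_of_linIndep`),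
by induction down the tower (the tower closes on itself; no appeal to `SingleAt`); in the literature's
words `fh_decided_of_polylogIndep` (hypothesis: `1, Li_1(−1/q₀), …, Li_n(−1/q₀)` ℚ-independent).  (iii) the
dimension-2 census class `Q = q₀ + xy` read against the literature:
`fermatHyperbolicResidual_one_of_dilog_new : (∀ c₀ c₁ : ℚ, L_2(q₀) ≠ c₀ + c₁·log((q₀+1)/q₀)) →
FermatHyperbolicResidual 1 q₀`.
THE INPUT is a THEOREM on explicit ranges (Literature, cited, not formalised; `x = −1/q₀ = 1/b`):
`1, Li_1(1/b), …, Li_r(1/b)` are ℚ-linearly independent for `b ∈ ℤ`, `log|b| > log E(r)`,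
`E(r) = e^{r²} rʳ (e^{−r}+1)^{r+1}/(r+1)^{r+1}` [Hata 1990, J. Math. Pures Appl. 69, Cor. 2.2; quoted with
the table `log E(1..4) = 0.2402, 2.4712, 6.945, 13.5887`, i.e. `|b| ≥ 2, 12, 1038, 797 102`, in
David–Hirata-Kohno–Kawashima, arXiv:2010.09167, Remark 5 p.36 (Hata's `b < 0` bounds — our `q₀ > 0` —
slightly better)]; for `r = 2` down to `b ≤ −5 ∨ b ≥ 6` [Hata 1993, TAMS 336, Table 2; Rhin–Viola 2005;
Rhin–Viola 2019, §5 + Table 1: `s⁻(1) = −5`, `s⁺(1) = 6`; also `x = 2/s, 3/s, 4/s`: `s⁺ = 51, 173, 423`],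
i.e. `TopLetterNew q₀ 1` (indeed `LettersLinIndep q₀ 2`) for integers `q₀ ≥ 5 ∨ q₀ ≤ −6`; general
algebraic `x` close to `0`: [DHK 2020, Thm 3]; first results Maier 1927, Nikishin 1979 (Mat. Sb. 109).
CEILING of that method family (Padé / hypergeometric / permutation group): it needs `|x|` small against
the arithmetic loss (`log|b| > log E(r) > 0`), so `q₀ = ±1` — in particular the census-central `1 + xy`
(`1, log 2, π²/12`) — is OUTSIDE every proved range and stays in the generic residual (C); there
`TopLetterNew 1 n` is an open problem, not a barrier theorem.
WHY STRICTLY WEAKER / DIFFERENT IN KIND. (B) is implied by 26322 (it is 26322 restricted to one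
denominator per `(n, q₀)`, with the extra information `N = 0`), and on the cited ranges it is now a
THEOREM; the residual (C) is 26322 minus a class on which the de Rham obstruction is live.
-/

section Diophantine

variable {n : ℕ}

/-- Evaluation of the tower denominator. [folklore] -/
theorem aeval_fhQ (q₀ : ℚ) (y : Fin n → ℝ) : aeval y (fhQ n q₀) = (q₀ : ℝ) + ∏ i, y i := by
  rw [fhQ_eq, map_add, MvPolynomial.aeval_C, map_prod]
  simp only [eq_ratCast, MvPolynomial.aeval_X]

/-- On the closed cube `0 ≤ ∏ xᵢ ≤ 1`. [folklore] -/
theorem prod_mem_Icc_of_mem_cube {x : Fin n → ℝ} (hx : x ∈ KZ.cube n) :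
    0 ≤ ∏ i, x i ∧ ∏ i, x i ≤ 1 :=
  ⟨Finset.prod_nonneg fun i _ => ((KZ.mem_cube.1 hx) i).1,
   Finset.prod_le_one (fun i _ => ((KZ.mem_cube.1 hx) i).1) fun i _ => ((KZ.mem_cube.1 hx) i).2⟩

/-- `q₀ + x₀⋯x_{n-1}` has no zero on the closed cube when `q₀ > 0` or `q₀ < −1`. [folklore] -/
theorem fhQ_ne_zero_of (q₀ : ℚ) (hq : 0 < q₀ ∨ q₀ < -1) (x : Fin n → ℝ) (hx : x ∈ KZ.cube n) :
    aeval x (fhQ n q₀) ≠ 0 := by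
  rw [aeval_fhQ]
  obtain ⟨h0, h1⟩ := prod_mem_Icc_of_mem_cube hx
  rcases hq with hq | hq
  · have : (0 : ℝ) < q₀ := by exact_mod_cast hq
    exact ne_of_gt (by linarith)
  · have : (q₀ : ℝ) < -1 := by exact_mod_cast hq
    exact ne_of_lt (by linarith)

/-- The value of a cube representation is the integral of its function over the cube. [folklore] -/
theorem value_rep_eq (T : RFun M) : T.rep.value = ∫ x in KZ.cube M, T.fn x := rfl

/-- Representations with the same function on the closed cube have the same value.
[cite: KontsevichZagier2001, §1.2 rule (1)] -/
theorem value_eq_of_fn_eq {T S : RFun M} (h : ∀ x ∈ KZ.cube M, T.fn x = S.fn x) :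
    T.rep.value = S.rep.value := by
  rw [← eval_of, ← eval_of]
  exact eval_eq_of_sub_mem (RFun.rel_of_eqOn h)

/-- `value [T + S] = value [T] + value [S]`. [cite: KontsevichZagier2001, §1.2 rule (1)] -/
theorem value_add (T S : RFun M) : (T.add S).rep.value = T.rep.value + S.rep.value := by
  have h := relations_le_ker_eval_holds (RFun.rel_add T S)
  rw [AddMonoidHom.mem_ker, map_sub, map_sub, eval_of, eval_of, eval_of] at h
  linarith

variable (q₀ : ℚ) (hq : 0 < q₀ ∨ q₀ < -1)

/-- The tower representation `[ [0,1]^n, P/(q₀ + x₀⋯x_{n-1}) ]`. [folklore] -/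
def fhR (n : ℕ) (P : MvPolynomial (Fin n) ℚ) : RFun n :=
  ⟨P, fhQ n q₀, fun x hx => fhQ_ne_zero_of q₀ hq x hx⟩

/-- Auxiliary step `fhR_num` (§17): fh R num. [bookkeeping] -/
@[simp] theorem fhR_num (P : MvPolynomial (Fin n) ℚ) : (fhR q₀ hq n P).num = P := rfl

/-- Auxiliary step `fhR_den` (§17): fh R den. [bookkeeping] -/
@[simp] theorem fhR_den (P : MvPolynomial (Fin n) ℚ) : (fhR q₀ hq n P).den = fhQ n q₀ := rfl

/-- Auxiliary step `fhR_fn` (§17): fh R fn. [bookkeeping] -/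
theorem fhR_fn (P : MvPolynomial (Fin n) ℚ) (x : Fin n → ℝ) :
    (fhR q₀ hq n P).fn x = aeval x P / aeval x (fhQ n q₀) := rfl

/-- Its value `∫_{[0,1]^n} P/(q₀ + ∏ xᵢ) dx`. [folklore] -/
def fhV (n : ℕ) (P : MvPolynomial (Fin n) ℚ) : ℝ := (fhR q₀ hq n P).rep.value

/-- THE LETTERS `L_j(q₀) = ∫_{[0,1]^j} dx/(q₀ + x₁⋯x_j)` (`= −Li_j(−1/q₀)` for `j ≥ 1`; `L_0 = 1/(q₀+1)`).
[folklore] -/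
def letter (j : ℕ) : ℝ := fhV q₀ hq j 1

/-- Additivity in the numerator. [folklore] -/
theorem fhV_add (P P' : MvPolynomial (Fin n) ℚ) :
    fhV q₀ hq n (P + P') = fhV q₀ hq n P + fhV q₀ hq n P' := by
  unfold fhV
  rw [← value_add]
  refine value_eq_of_fn_eq fun x hx => ?_
  rw [RFun.fn_add hx]
  simp only [fhR_fn, map_add, add_div]

/-- `ℚ`-homogeneity in the numerator. [folklore] -/
theorem fhV_C_mul (a : ℚ) (P : MvPolynomial (Fin n) ℚ) :
    fhV q₀ hq n (C a * P) = a * fhV q₀ hq n P := by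
  unfold fhV
  rw [value_rep_eq, value_rep_eq, ← integral_const_mul]
  have : (fun x => (fhR q₀ hq n (C a * P)).fn x) = fun x => (a : ℝ) * (fhR q₀ hq n P).fn x := by
    funext x
    simp only [fhR_fn, map_mul, MvPolynomial.aeval_C, eq_ratCast, mul_div_assoc]
  rw [this]

/-- `ℚ`-linear combinations in the numerator. [folklore] -/
theorem fhV_sub (P P' : MvPolynomial (Fin n) ℚ) :
    fhV q₀ hq n (P - P') = fhV q₀ hq n P - fhV q₀ hq n P' := by
  have h := fhV_add q₀ hq (P - P') P'
  rw [sub_add_cancel] at h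
  linarith

/-- Auxiliary step `fhV_sum` (§17): fh V sum. [bookkeeping] -/
theorem fhV_sum {ι : Type*} (s : Finset ι) (f : ι → MvPolynomial (Fin n) ℚ) :
    fhV q₀ hq n (∑ i ∈ s, f i) = ∑ i ∈ s, fhV q₀ hq n (f i) := by
  classical
  induction s using Finset.induction_on with
  | empty =>
    rw [Finset.sum_empty, Finset.sum_empty, show (0 : MvPolynomial (Fin n) ℚ) = C 0 * 1 by simp,
      fhV_C_mul, Rat.cast_zero, zero_mul]
  | insert i s hi ih => rw [Finset.sum_insert hi, Finset.sum_insert hi, fhV_add, ih]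

/-- Dimension `0`: the value is the rational number `P()/(q₀ + 1)`. [folklore] -/
theorem fhV_zero_rational (P : MvPolynomial (Fin 0) ℚ) : ∃ c : ℚ, fhV q₀ hq 0 P = c := by
  refine ⟨P.coeff 0 / (q₀ + 1), ?_⟩
  have hfn : ∀ x : Fin 0 → ℝ, (fhR q₀ hq 0 P).fn x = ((P.coeff 0 / (q₀ + 1) : ℚ) : ℝ) := by
    intro x
    rw [fhR_fn, aeval_fhQ, Fintype.prod_empty]
    conv_lhs => rw [MvPolynomial.eq_C_of_isEmpty P, MvPolynomial.aeval_C, eq_ratCast]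
    rw [Rat.cast_div, Rat.cast_add, Rat.cast_one]
  unfold fhV
  rw [value_rep_eq, setIntegral_congr_fun KZ.measurableSet_cube (fun x _ => hfn x), setIntegral_const,
    KZ.volume_real_cube, one_smul]

/-! ### Faces of the tower stay in the tower -/

/-- The substitution `x_k := c`, the other variables re-indexed along `k.succAbove`. [folklore] -/
def insX (k : Fin (n + 1)) (c : ℚ) : Fin (n + 1) → MvPolynomial (Fin n) ℚ :=
  Fin.insertNth (α := fun _ => MvPolynomial (Fin n) ℚ) k (C c) fun j => X j

/-- Auxiliary step `aeval_insX` (§17): aeval ins X. [bookkeeping] -/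
theorem aeval_insX (k : Fin (n + 1)) (c : ℚ) (x : Fin n → ℝ) :
    (fun i => aeval x (insX k c i)) = Fin.insertNth k (c : ℝ) x := by
  funext i
  induction i using Fin.succAboveCases k with
  | x => simp [insX, Fin.insertNth_apply_same, eq_ratCast]
  | p j => simp [insX, Fin.insertNth_apply_succAbove]

/-- Auxiliary step `aeval_bind₁_insX` (§17): aeval bind₁ ins X. [bookkeeping] -/
theorem aeval_bind₁_insX (k : Fin (n + 1)) (c : ℚ) (G : MvPolynomial (Fin (n + 1)) ℚ) (x : Fin n → ℝ) :
    aeval x (bind₁ (insX k c) G) = aeval (Fin.insertNth k (c : ℝ) x) G := by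
  rw [aeval_bind₁, aeval_insX]

/-- Auxiliary step `aeval_fhQ_insertNth` (§17): aeval fh Q insert Nth. [bookkeeping] -/
theorem aeval_fhQ_insertNth (k : Fin (n + 1)) (c : ℝ) (x : Fin n → ℝ) :
    aeval (Fin.insertNth k c x) (fhQ (n + 1) q₀) = (q₀ : ℝ) + c * ∏ j, x j := by
  rw [aeval_fhQ, Fin.prod_univ_succAbove _ k, Fin.insertNth_apply_same]
  simp only [Fin.insertNth_apply_succAbove]

include hq in
/-- Auxiliary step `q₀_ne_zero` (§17): q₀ ne zero. [bookkeeping] -/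
private theorem q₀_ne_zero : (q₀ : ℝ) ≠ 0 := by
  have : q₀ ≠ 0 := by
    rcases hq with h | h
    · exact h.ne'
    · exact (lt_trans h (by norm_num : (-1 : ℚ) < 0)).ne
  exact_mod_cast this

/-- The face `x_k = 1` of a potential `G_k/(q₀ + ∏ xᵢ)` is `G_k|_{x_k=1}/(q₀ + ∏_{i≠k} xᵢ)`. [folklore] -/
theorem face_one_fn (P : MvPolynomial (Fin (n + 1)) ℚ) (Gk : MvPolynomial (Fin (n + 1)) ℚ) (k : Fin (n + 1))
    (x : Fin n → ℝ) (_hx : x ∈ KZ.cube n) :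
    ((Wp (fhR q₀ hq (n + 1) P) 0 Gk).faceAt k 1 zero_le_one_and).fn x
      = (fhR q₀ hq n (bind₁ (insX k 1) Gk)).fn x := by
  rw [RFun.fn_faceAt, RFun.fn_apply, fhR_fn]
  show aeval (Fin.insertNth k ((1 : ℚ) : ℝ) x) Gk / aeval (Fin.insertNth k ((1 : ℚ) : ℝ) x) (fhQ (n + 1) q₀ ^ (0 + 1))
    = aeval x (bind₁ (insX k 1) Gk) / aeval x (fhQ n q₀)
  rw [zero_add, pow_one, Rat.cast_one, aeval_fhQ_insertNth, one_mul, aeval_bind₁_insX, Rat.cast_one, aeval_fhQ]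

/-- The face `x_k = 0` of a potential `G_k/(q₀ + ∏ xᵢ)` is `G_k|_{x_k=0}/q₀`, rewritten over the tower
denominator as `(q₀⁻¹ · G_k|_{x_k=0} · (q₀ + ∏_{i≠k} xᵢ))/(q₀ + ∏_{i≠k} xᵢ)`. [folklore] -/
theorem face_zero_fn (P : MvPolynomial (Fin (n + 1)) ℚ) (Gk : MvPolynomial (Fin (n + 1)) ℚ) (k : Fin (n + 1))
    (x : Fin n → ℝ) (hx : x ∈ KZ.cube n) :
    ((Wp (fhR q₀ hq (n + 1) P) 0 Gk).faceAt k 0 le_rfl_and).fn x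
      = (fhR q₀ hq n (C q₀⁻¹ * bind₁ (insX k 0) Gk * fhQ n q₀)).fn x := by
  have hQn : aeval x (fhQ n q₀) ≠ 0 := fhQ_ne_zero_of q₀ hq x hx
  have hq0 : (q₀ : ℝ) ≠ 0 := q₀_ne_zero q₀ hq
  rw [RFun.fn_faceAt, RFun.fn_apply, fhR_fn]
  show aeval (Fin.insertNth k ((0 : ℚ) : ℝ) x) Gk / aeval (Fin.insertNth k ((0 : ℚ) : ℝ) x) (fhQ (n + 1) q₀ ^ (0 + 1))
    = aeval x (C q₀⁻¹ * bind₁ (insX k 0) Gk * fhQ n q₀) / aeval x (fhQ n q₀)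
  rw [zero_add, pow_one, Rat.cast_zero, aeval_fhQ_insertNth, zero_mul, add_zero, map_mul, map_mul,
    MvPolynomial.aeval_C, eq_ratCast, aeval_bind₁_insX, Rat.cast_zero, Rat.cast_inv, mul_div_assoc,
    div_self hQn, mul_one, mul_comm, ← div_eq_mul_inv]

/-- The merged numerator of the descended tower representation. [folklore] -/
def mergedNum (n : ℕ) (G : Fin (n + 1) → MvPolynomial (Fin (n + 1)) ℚ) : MvPolynomial (Fin n) ℚ :=
  ∑ k, (bind₁ (insX k 1) (G k) - C q₀⁻¹ * bind₁ (insX k 0) (G k) * fhQ n q₀)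

/-- Numerator sums at the level of formal representations. [cite: KontsevichZagier2001, §1.2 rule (1)] -/
theorem fhR_rel_sum {ι : Type*} (s : Finset ι) (f : ι → MvPolynomial (Fin n) ℚ) :
    KZ.of (fhR q₀ hq n (∑ i ∈ s, f i)).rep - ∑ i ∈ s, KZ.of (fhR q₀ hq n (f i)).rep ∈ KZ.relations :=
  RFun.rel_sum s (fun i => fhR q₀ hq n (f i)) _ fun x _ => by
    simp only [fhR_fn, map_sum, Finset.sum_div]

/-- Auxiliary step `fhR_rel_sub` (§17): fh R rel sub. [bookkeeping] -/
theorem fhR_rel_sub (A B : MvPolynomial (Fin n) ℚ) :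
    KZ.of (fhR q₀ hq n (A - B)).rep - (KZ.of (fhR q₀ hq n A).rep - KZ.of (fhR q₀ hq n B).rep)
      ∈ KZ.relations := by
  have h1 : KZ.of (fhR q₀ hq n (A - B)).rep - KZ.of ((fhR q₀ hq n A).sub (fhR q₀ hq n B)).rep
      ∈ KZ.relations :=
    RFun.rel_of_eqOn fun x hx => by rw [RFun.fn_sub hx]; simp only [fhR_fn, map_sub, sub_div]
  have h2 := RFun.rel_sub (fhR q₀ hq n A) (fhR q₀ hq n B)
  have heq : KZ.of (fhR q₀ hq n (A - B)).rep - (KZ.of (fhR q₀ hq n A).rep - KZ.of (fhR q₀ hq n B).rep)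
      = (KZ.of (fhR q₀ hq n (A - B)).rep - KZ.of ((fhR q₀ hq n A).sub (fhR q₀ hq n B)).rep)
        + (KZ.of ((fhR q₀ hq n A).sub (fhR q₀ hq n B)).rep
          - (KZ.of (fhR q₀ hq n A).rep - KZ.of (fhR q₀ hq n B).rep)) := by abel
  rw [heq]
  exact add_mem h1 h2

end Diophantine
end Summit.KontsevichZagierPeriods.RootDecompRationalCubeDichotomy.Rung26322.RankDescent
end
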